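import Literature.NumberTheory.Sieve.MatomakiRadziwillProp1E1
import Literature.NumberTheory.Sieve.MatomakiRadziwillTheorem3
import HarnessLib

/-!
# Matomäki–Radziwiłł 2016, Proposition 1 — part (c): the bound for `E_j`, `j ≥ 2` (§8.2)

Topic `NumberTheory/Sieve`; third file of the assembly of `MatomakiRadziwill2016_prop1` (Proposition 1
of Matomäki–Radziwiłł, Ann. of Math. 183 (2016), §8), after `MatomakiRadziwillProp1Partition.lean`
(partition, reduction (23)) and `MatomakiRadziwillProp1E1.lean` (`E_1`).  Everything is proved; Lemma 13
of the paper (the moment computation, named fact `MatomakiRadziwill2016_lemma13` of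
`MatomakiRadziwillProp1Inputs.lean`) enters as an explicit hypothesis `h13` in the shape of that fact's
body (`∀ X T Y₁ Y₂ a c, … ≤ C₁₃ (T/X + 2^ℓ Y₁)((ℓ+1)!)²`), so the results are conditional on it exactly
as the paper is.

§8.2 of the paper: for `2 ≤ j ≤ J`, split `𝒯_j = ⋃_{r ∈ ℐ_{j-1}} 𝒯_{j,r}` according to a large block
polynomial `|Q_{r,H_{j-1}}(1+it)| > e^{-α_{j-1} r/H_{j-1}}` at the previous level (such `r` exists since
`t ∈ 𝒯_j` is not good at level `j - 1`); on `𝒯_{j,r}` multiply by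
`(|Q_{r,H_{j-1}}| e^{α_{j-1} r/H_{j-1}})^{2ℓ} ≥ 1` with `ℓ = ⌈(v/H_j)/(r/H_{j-1})⌉`, apply Lemma 13 to
`Q_{r,H_{j-1}}^ℓ R_{v,H_j}`, and do the bookkeeping with conditions (2), (3):
`E_j ≪ (T/X + 1) j⁶ Q_{j-1}³ exp(-(η/(2j²)) log P_j) ≪ (T/X + 1)/(j² Q_{j-1})`.

## Main results (all in `namespace SieveIntervalSystem`, dot notation on `I : SieveIntervalSystem η X`)

* growth of the system: `loglogQ_ge` (`log log Q_j ≥ j - 1`), `four_div_logP_sub_one_le`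
  (`4/(log P_{j-1} - 1) ≤ η/(j²(j-1))`, from (2)), `two_le_logP`, `Q_pow_four_mul_le`
  (`Q_{j-1}⁴ j⁸ ≤ P_j^{η/(2j²)}`, (3) exponentiated), `logQ_le_Q_pred_rpow` (`log Q_j ≤ Q_{j-1}^{1/96}`, from (2)),
  `Hpar_cube_le` (`H_j³ ≤ j⁶ P₁^{1/2}`), `card_blocks_le` (`#ℐ_j ≤ 2 H_j log Q_j`);
* the refinement: `bigSet`, `Tsub` (= `𝒯_{j,r}`, made disjoint in `r` by taking the least witness `r`),
  `Tset_eq_biUnion_Tsub`, `integral_Tset_eq_sum_Tsub`, `norm_sq_le_on_Tsub` (the amplification);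
* matching Lemma 13: `blockPrimePoly_eq_sum_Icc` (for `H ≥ 2` the block `[e^{r/H}, e^{(r+1)/H})` lies in
  `[Y₁, 2Y₁]`), `blockCofactorPoly_eq_sum_Icc`, `lemma13_block`;
* the bookkeeping, made rigorous with explicit constants: `exponent_bound`
  (`e^{-2α_j x} e^{2ℓα_{j-1}y} 2^ℓ ((ℓ+1)!)² ≤ e^{-(η/(2j²))x} e^{L'/2} L⁴ e⁶` for `1 ≤ y₀ ≤ y ≤ x ≤ L`,
  `y ≤ L'`, `log L ≤ (η/(4j²)) y₀`, `4/y₀ ≤ η/(j²(j-1))`; here the paper's "`ℓ log ℓ ≤ … + log log Q_j + 1`"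
  is replaced by `(ℓ+1)! ≤ (ℓ+1)^{ℓ+1}`, `log(ℓ+1) ≤ log 3 + log L` and `log log Q_j ≥ j - 1`);
* `integral_Tsub_le`, `integral_Tsub_le'` — `∫_{𝒯_{j,r}} |Q_{v,H_j} R_{v,H_j}|² ≤ max(C₁₃,0)(T/X+1) e⁷ j⁻⁸ Q_{j-1}^{-59/24}`;
* `E_j_le` — **the bound for `E_j`**: for `0 < η < 1/6`, `H₁ ≥ 2`, `X, T ≥ 1`, `T₀ ≥ 0`, `j ≥ 2`,
  `C₁₂ H_j log(Q_j/P_j) ∑_{v∈ℐ_j} ∫_{𝒯_j} |Q_{v,H_j} R_{v,H_j}|² ≤ 10⁸ max(C₁₃,0) (T/X + 1)/(j² Q_{j-1})`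
  (`C₁₂ = 20000`), whence `≤ 10⁸ max(C₁₃,0)(T/X+1)/(j² P₁)` by `P_one_le_Q_pred`.

The hypothesis `H₁ ≥ 2` (rather than `≥ 1`) makes `e^{1/H_{j-1}} ≤ 2`, so that a prime block is a
Lemma-13 polynomial on `[Y₁, 2Y₁]`; the case `H₁ < 2` of Proposition 1 is covered by the trivial bound
(`SieveIntervalSystem.integral_trivial_le`), since then its first error term exceeds `1/2`.

## References

* K. Matomäki, M. Radziwiłł, *Multiplicative functions in short intervals*, Ann. of Math. (2) 183
  (2016), 1015–1056, doi:10.4007/annals.2016.183.3.6, arXiv:1501.04585: §8.2 (arXiv pp. 16–17), §2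
  (2), (3), Lemma 13 (§6).
-/

noncomputable section

open Finset Complex MeasureTheory

namespace Literature.NumberTheory.Sieve

namespace SieveIntervalSystem

variable {η X : ℝ} (I : SieveIntervalSystem η X)

/-! ### Growth of the interval system: consequences of (2) and (3) -/

/-- `log log Q_j ≥ j - 1` for `j ≥ 2` (from (3): `log Q_j ≥ 432 log Q_{j-1}` for `j ≥ 3`, and
`log Q₂ ≥ 24 · 16 log 2 ≥ e`). [folklore] -/
theorem loglogQ_ge (hη : 0 < η) (hη' : η ≤ 1 / 6) {j : ℕ} (hj : 2 ≤ j) :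
    (j : ℝ) - 1 ≤ Real.log (Real.log (I.Q j)) := by
  induction j, hj using Nat.le_induction with
  | base =>
    have h := MatomakiRadziwillThm3.logQ_succ_ge I hη (le_refl 2)
    norm_num at h
    have hQ1 : 0 ≤ Real.log (I.Q 1) := MatomakiRadziwillThm3.logQ_nonneg I hη le_rfl
    have hlog2 : (0.69 : ℝ) < Real.log 2 := by linarith [Real.log_two_gt_d9]
    have h4 : (24 : ℝ) ≤ 4 / η := by rw [le_div_iff₀ hη]; nlinarith
    have hQ2 : Real.exp 1 ≤ Real.log (I.Q 2) := by
      have h1 : 16 * 0.69 ≤ 8 * Real.log (I.Q 1) + 16 * Real.log 2 := by nlinarith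
      have h2 : (24 : ℝ) * (16 * 0.69) ≤ 4 / η * (8 * Real.log (I.Q 1) + 16 * Real.log 2) :=
        mul_le_mul h4 h1 (by norm_num) (by positivity)
      linarith [Real.exp_one_lt_three.le]
    have := Real.log_le_log (Real.exp_pos 1) hQ2
    rw [Real.log_exp] at this
    norm_num
    linarith
  | succ k hk ih =>
    have h := MatomakiRadziwillThm3.logQ_succ_ge I hη (show 2 ≤ k + 1 by omega)
    simp only [Nat.add_sub_cancel] at h
    have hQk0 : 0 ≤ Real.log (I.Q k) := MatomakiRadziwillThm3.logQ_nonneg I hη (by omega)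
    have hk2 : (2 : ℝ) ≤ k := by exact_mod_cast hk
    have hllk : 0 < Real.log (Real.log (I.Q k)) := by linarith
    have hQk : 1 < Real.log (I.Q k) := (Real.log_pos_iff hQk0).1 hllk
    have hk1 : (3 : ℝ) ≤ ((k + 1 : ℕ) : ℝ) := by push_cast; linarith
    have hcoef : (432 : ℝ) ≤ ((k + 1 : ℕ) : ℝ) ^ 2 / η * 8 := by
      rw [div_mul_eq_mul_div, le_div_iff₀ hη]; nlinarith
    have hlogk : 0 ≤ Real.log ((k + 1 : ℕ) : ℝ) := Real.log_nonneg (by linarith)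
    have h1 : 432 * Real.log (I.Q k) ≤ Real.log (I.Q (k + 1)) :=
      calc 432 * Real.log (I.Q k) ≤ ((k + 1 : ℕ) : ℝ) ^ 2 / η * 8 * Real.log (I.Q k) :=
            mul_le_mul_of_nonneg_right hcoef hQk0
        _ ≤ ((k + 1 : ℕ) : ℝ) ^ 2 / η * (8 * Real.log (I.Q k) + 16 * Real.log ((k + 1 : ℕ) : ℝ)) := by
            have : 0 ≤ ((k + 1 : ℕ) : ℝ) ^ 2 / η * (16 * Real.log ((k + 1 : ℕ) : ℝ)) := by positivity
            nlinarith
        _ ≤ Real.log (I.Q (k + 1)) := h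
    have h2 := Real.log_le_log (by positivity) h1
    rw [Real.log_mul (by norm_num) (by linarith)] at h2
    have h432 : 1 ≤ Real.log 432 := by
      rw [← Real.log_exp 1]
      exact Real.log_le_log (Real.exp_pos 1) (by linarith [Real.exp_one_lt_three.le])
    push_cast
    linarith

/-- `log Q_j > 1` (indeed `log log Q_j ≥ j - 1 ≥ 1`) for `j ≥ 2`; together with `one_lt_log_Q_one`,
`log Q_j > 1` for all `j ≥ 1`. [folklore] -/
theorem one_lt_logQ (hη : 0 < η) (hη' : η ≤ 1 / 6) {j : ℕ} (hj : 1 ≤ j) : 1 < Real.log (I.Q j) := by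
  rcases eq_or_lt_of_le hj with h | h
  · rw [← h]; exact I.one_lt_log_Q_one hη (by linarith)
  · have h2 : 2 ≤ j := by omega
    have hll := I.loglogQ_ge hη hη' h2
    have hj2 : (2 : ℝ) ≤ j := by exact_mod_cast h2
    have hQ0 : 0 ≤ Real.log (I.Q j) := MatomakiRadziwillThm3.logQ_nonneg I hη hj
    exact (Real.log_pos_iff hQ0).1 (by linarith)

/-- **Condition (2), first consequence**: `log P_{j-1} - 1 ≥ (4j²/η) log log Q_j ≥ (4j²/η)(j - 1)`, hence
`4/(log P_{j-1} - 1) ≤ η/(j²(j-1))` for `j ≥ 2`. [cite: MatomakiRadziwillAnnals2016, §2 (2)] -/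
theorem four_div_logP_sub_one_le (hη : 0 < η) (hη' : η ≤ 1 / 6) {j : ℕ} (hj : 2 ≤ j) :
    4 / (Real.log (I.P (j - 1)) - 1) ≤ η / ((j : ℝ) ^ 2 * ((j : ℝ) - 1)) := by
  have h2 := I.notTooFar j hj
  have hll := I.loglogQ_ge hη hη' hj
  have hj2 : (2 : ℝ) ≤ j := by exact_mod_cast hj
  have hjpos : 0 < (j : ℝ) - 1 := by linarith
  have hc : 0 < η / (4 * (j : ℝ) ^ 2) := by positivity
  -- `(j-1) ≤ η/(4j²) (log P_{j-1} - 1)`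
  have h3 : (j : ℝ) - 1 ≤ η / (4 * (j : ℝ) ^ 2) * (Real.log (I.P (j - 1)) - 1) := hll.trans h2
  have hy : 0 < Real.log (I.P (j - 1)) - 1 := by
    by_contra hle; push Not at hle
    have : η / (4 * (j : ℝ) ^ 2) * (Real.log (I.P (j - 1)) - 1) ≤ 0 :=
      mul_nonpos_of_nonneg_of_nonpos hc.le hle
    linarith
  rw [div_le_div_iff₀ hy (by positivity)]
  -- `4 j² (j-1) ≤ η (log P - 1)`
  have h4 : 4 * (j : ℝ) ^ 2 * ((j : ℝ) - 1) ≤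
      4 * (j : ℝ) ^ 2 * (η / (4 * (j : ℝ) ^ 2) * (Real.log (I.P (j - 1)) - 1)) :=
    mul_le_mul_of_nonneg_left h3 (by positivity)
  have hid : 4 * (j : ℝ) ^ 2 * (η / (4 * (j : ℝ) ^ 2) * (Real.log (I.P (j - 1)) - 1)) =
      η * (Real.log (I.P (j - 1)) - 1) := by
    field_simp
  linarith

/-- **Condition (2), second consequence**: `log P_{j-1} - 1 ≥ 1` (indeed `≥ 4j²/η ≥ 96`) for `j ≥ 2`,
i.e. `log P_i ≥ 2` for all `i ≥ 1`. [folklore] -/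
theorem two_le_logP (hη : 0 < η) (hη' : η ≤ 1 / 6) {i : ℕ} (hi : 1 ≤ i) : 2 ≤ Real.log (I.P i) := by
  have h := I.four_div_logP_sub_one_le hη hη' (show 2 ≤ i + 1 by omega)
  simp only [Nat.add_sub_cancel] at h
  have hi1 : (1 : ℝ) ≤ i := by exact_mod_cast hi
  have hj2 : (2 : ℝ) ≤ ((i + 1 : ℕ) : ℝ) := by push_cast; linarith
  have hrhs : η / (((i + 1 : ℕ) : ℝ) ^ 2 * (((i + 1 : ℕ) : ℝ) - 1)) ≤ 1 := by
    rw [div_le_one (by nlinarith)]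
    nlinarith
  have h1 : 4 / (Real.log (I.P i) - 1) ≤ 1 := h.trans hrhs
  by_contra hlt; push Not at hlt
  rcases le_or_gt (Real.log (I.P i) - 1) 0 with h0 | h0
  · -- then `4/(…) ≤ 0 ≤ 1` is consistent; use (2) directly: `log P_i - 1 > 0`
    have h2 := I.notTooFar (i + 1) (by omega)
    simp only [Nat.add_sub_cancel] at h2
    have hll := I.loglogQ_ge hη hη' (show 2 ≤ i + 1 by omega)
    have : η / (4 * ((i + 1 : ℕ) : ℝ) ^ 2) * (Real.log (I.P i) - 1) ≤ 0 :=
      mul_nonpos_of_nonneg_of_nonpos (by positivity) h0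
    push_cast at hll this h2
    linarith
  · rw [div_le_one h0] at h1
    linarith

/-- **Condition (3), exponentiated**: `Q_{j-1}^4 · j^8 ≤ P_j^{η/(2j²)}` for `j ≥ 2`.
[cite: MatomakiRadziwillAnnals2016, §2 (3)] -/
theorem Q_pow_four_mul_le (hη : 0 < η) {j : ℕ} (hj : 2 ≤ j) :
    I.Q (j - 1) ^ 4 * (j : ℝ) ^ 8 ≤ I.P j ^ (η / (2 * (j : ℝ) ^ 2)) := by
  have h3 := I.notTooClose j hj
  have hQ : 0 < I.Q (j - 1) := I.pos_Q (by omega)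
  have hP : 0 < I.P j := I.pos_P j (by omega)
  have hj0 : (0 : ℝ) < j := by exact_mod_cast (show 0 < j by omega)
  -- halve (3): `4 log Q_{j-1} + 8 log j ≤ η/(2j²) log P_j`
  have h : 4 * Real.log (I.Q (j - 1)) + 8 * Real.log j ≤ η / (2 * (j : ℝ) ^ 2) * Real.log (I.P j) := by
    have : η / (2 * (j : ℝ) ^ 2) * Real.log (I.P j) = (η / (j : ℝ) ^ 2 * Real.log (I.P j)) / 2 := by
      field_simp
    rw [this]
    linarith
  have := Real.exp_le_exp.2 h
  rw [Real.exp_add, show 4 * Real.log (I.Q (j - 1)) = (4 : ℕ) * Real.log (I.Q (j - 1)) by norm_num,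
    show 8 * Real.log (j : ℝ) = (8 : ℕ) * Real.log (j : ℝ) by norm_num,
    Real.exp_nat_mul, Real.exp_nat_mul, Real.exp_log hQ, Real.exp_log hj0,
    mul_comm (η / (2 * (j : ℝ) ^ 2)) (Real.log (I.P j)), ← Real.rpow_def_of_pos hP] at this
  exact this

/-- **Condition (2), third consequence**: `log Q_j ≤ Q_{j-1}^{1/96}` for `j ≥ 2` and `η ≤ 1/6`
(`log log Q_j ≤ (η/(4j²))(log P_{j-1} - 1) ≤ (1/96) log Q_{j-1}`). [cite: MatomakiRadziwillAnnals2016, §2 (2)] -/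
theorem logQ_le_Q_pred_rpow (hη : 0 < η) (hη' : η ≤ 1 / 6) {j : ℕ} (hj : 2 ≤ j) :
    Real.log (I.Q j) ≤ I.Q (j - 1) ^ (1 / 96 : ℝ) := by
  have h2 := I.notTooFar j hj
  have hQ : 0 < I.Q (j - 1) := I.pos_Q (by omega)
  have hPQ : Real.log (I.P (j - 1)) ≤ Real.log (I.Q (j - 1)) :=
    Real.log_le_log (I.pos_P _ (by omega)) (I.P_le_Q _ (by omega))
  have hlogP : 2 ≤ Real.log (I.P (j - 1)) := I.two_le_logP hη hη' (by omega)
  have hj2 : (2 : ℝ) ≤ j := by exact_mod_cast hj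
  have hcoef : η / (4 * (j : ℝ) ^ 2) ≤ 1 / 96 := by
    rw [div_le_div_iff₀ (by positivity) (by norm_num)]
    nlinarith
  have hlogQj : 1 < Real.log (I.Q j) := I.one_lt_logQ hη hη' (by omega)
  have h : Real.log (Real.log (I.Q j)) ≤ 1 / 96 * Real.log (I.Q (j - 1)) :=
    calc Real.log (Real.log (I.Q j)) ≤ η / (4 * (j : ℝ) ^ 2) * (Real.log (I.P (j - 1)) - 1) := h2
      _ ≤ 1 / 96 * (Real.log (I.P (j - 1)) - 1) :=
          mul_le_mul_of_nonneg_right hcoef (by linarith)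
      _ ≤ 1 / 96 * Real.log (I.Q (j - 1)) := by linarith
  have := Real.exp_le_exp.2 h
  rwa [Real.exp_log (by linarith), mul_comm, ← Real.rpow_def_of_pos hQ] at this

/-- `H_j³ ≤ j⁶ P₁^{1/2}` (`H₁³ = P₁^{1/2-3η}/log Q₁ ≤ P₁^{1/2}`). [folklore] -/
theorem Hpar_cube_le (hη : 0 < η) (hη' : η ≤ 1 / 6) (j : ℕ) :
    I.Hpar j ^ 3 ≤ (j : ℝ) ^ 6 * I.P 1 ^ (1 / 2 : ℝ) := by
  have hP : 1 ≤ I.P 1 := I.one_le_P_one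
  have hP0 : 0 < I.P 1 := by linarith
  have hL : 1 < Real.log (I.Q 1) := I.one_lt_log_Q_one hη (by linarith)
  have hH1 : I.Hpar 1 ^ 3 ≤ I.P 1 ^ (1 / 2 : ℝ) := by
    unfold Hpar
    simp only [Nat.cast_one, one_pow, one_mul]
    rw [div_pow, ← Real.rpow_natCast (I.P 1 ^ (1 / 6 - η)) 3, ← Real.rpow_mul hP0.le,
      ← Real.rpow_natCast (Real.log (I.Q 1) ^ (1 / 3 : ℝ)) 3, ← Real.rpow_mul (by linarith)]
    norm_num
    calc I.P 1 ^ ((1 / 6 - η) * 3) / Real.log (I.Q 1) ≤ I.P 1 ^ ((1 / 6 - η) * 3) :=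
          div_le_self (by positivity) hL.le
      _ ≤ I.P 1 ^ (1 / 2 : ℝ) := Real.rpow_le_rpow_of_exponent_le hP (by linarith)
  rw [I.Hpar_eq j, mul_pow, ← pow_mul]
  exact mul_le_mul_of_nonneg_left hH1 (by positivity)

/-- `#ℐ_j ≤ 2 H_j log Q_j` when `H_j ≥ 1` (`#ℐ_j ≤ H_j log(Q_j/P_j) + 2` and `log Q_j ≥ 2`). [folklore] -/
theorem card_blocks_le (hη : 0 < η) (hη' : η ≤ 1 / 6) {j : ℕ} (hj : 1 ≤ j) (hH : 1 ≤ I.Hpar j) :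
    (#(I.blocks j) : ℝ) ≤ 2 * (I.Hpar j * Real.log (I.Q j)) := by
  have h := MatomakiRadziwillLemma12.card_blocks_le (H := I.Hpar j) (by linarith)
    (I.one_le_P hη (by linarith) hj) (I.P_le_Q j hj)
  unfold blocks
  refine h.trans ?_
  have hlogP : 2 ≤ Real.log (I.P j) := I.two_le_logP hη hη' hj
  have hQ : 0 < I.Q j := I.pos_Q hj
  have hP : 0 < I.P j := I.pos_P j hj
  rw [Real.log_div hQ.ne' hP.ne']
  have hlogQ : 2 ≤ Real.log (I.Q j) := hlogP.trans (Real.log_le_log hP (I.P_le_Q j hj))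
  nlinarith

/-! ### The refinement `𝒯_j = ⨆_{r ∈ ℐ_{j-1}} 𝒯_{j,r}` of §8.2 -/

/-- The set where the block polynomial `Q_{r,H_i}` is **large**: `|Q_{r,H_i}(1+it)| > e^{-α_i r/H_i}`
(the witnesses of "not good at level `i`"). [cite: MatomakiRadziwillAnnals2016, §8.2] -/
def bigSet (c : ℕ → ℂ) (i r : ℕ) : Set ℝ :=
  {t : ℝ | Real.exp (-(alpha η i * r / I.Hpar i)) <
    ‖blockPrimePoly c (I.P i) (I.Q i) (I.Hpar i) r t‖}

/-- `𝒯_{j,r}`: the `t ∈ 𝒯_j` whose LEAST witness `r' ∈ ℐ_{j-1}` of largeness at level `j - 1` is `r`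
(the paper's `𝒯_{j,r} = {t ∈ 𝒯_j : |Q_{r,H_{j-1}}(1+it)| > e^{-α_{j-1} r/H_{j-1}}}`, made disjoint in `r`).
Meaningful for `2 ≤ j` only (for `j = 1` it refers to the junk level `0`, `α_0 = 1/4 - η`); every
consumer assumes `2 ≤ j`. [cite: MatomakiRadziwillAnnals2016, §8.2] -/
def Tsub (c : ℕ → ℂ) (T₀ T : ℝ) (j r : ℕ) : Set ℝ :=
  I.Tset c T₀ T j ∩ I.bigSet c (j - 1) r ∩
    ⋂ r' ∈ (I.blocks (j - 1)).filter (· < r), (I.bigSet c (j - 1) r')ᶜ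

/-- `bigSet` is open. [folklore] -/
theorem isOpen_bigSet (c : ℕ → ℂ) (i r : ℕ) : IsOpen (I.bigSet c i r) := by
  unfold bigSet
  have : Continuous fun t : ℝ => blockPrimePoly c (I.P i) (I.Q i) (I.Hpar i) r t := by
    unfold blockPrimePoly; exact MatomakiRadziwillLemma12.continuous_dsum _ _
  exact isOpen_lt continuous_const this.norm

/-- `𝒯_{j,r}` is measurable. [folklore] -/
theorem measurableSet_Tsub (c : ℕ → ℂ) (T₀ T : ℝ) (j r : ℕ) :
    MeasurableSet (I.Tsub c T₀ T j r) := by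
  unfold Tsub
  refine ((I.measurableSet_Tset c T₀ T j).inter (I.isOpen_bigSet c _ r).measurableSet).inter ?_
  exact MeasurableSet.biInter (Set.to_countable _)
    fun r' _ => (I.isOpen_bigSet c _ r').measurableSet.compl

/-- `𝒯_{j,r} ⊆ 𝒯_j`. [folklore] -/
theorem Tsub_subset (c : ℕ → ℂ) (T₀ T : ℝ) (j r : ℕ) : I.Tsub c T₀ T j r ⊆ I.Tset c T₀ T j :=
  fun _ ht => ht.1.1

/-- The `𝒯_{j,r}` are pairwise disjoint in `r`. [folklore] -/
theorem disjoint_Tsub (c : ℕ → ℂ) (T₀ T : ℝ) (j : ℕ) {r r' : ℕ} (hr : r ∈ I.blocks (j - 1))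
    (hr' : r' ∈ I.blocks (j - 1)) (hne : r ≠ r') :
    Disjoint (I.Tsub c T₀ T j r) (I.Tsub c T₀ T j r') := by
  rw [Set.disjoint_left]
  intro t ht ht'
  rcases lt_or_gt_of_ne hne with h | h
  · have h2 := ht'.2
    simp only [Set.mem_iInter, Set.mem_compl_iff] at h2
    exact h2 r (mem_filter.2 ⟨hr, h⟩) ht.1.2
  · have h2 := ht.2
    simp only [Set.mem_iInter, Set.mem_compl_iff] at h2
    exact h2 r' (mem_filter.2 ⟨hr', h⟩) ht'.1.2

/-- **`𝒯_j = ⋃_{r ∈ ℐ_{j-1}} 𝒯_{j,r}`** for `2 ≤ j`: a `t ∈ 𝒯_j` is not good at level `j - 1`, so some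
`Q_{r,H_{j-1}}(1+it)`, `r ∈ ℐ_{j-1}`, is large ("Note that this is indeed a splitting").
[cite: MatomakiRadziwillAnnals2016, §8.2] -/
theorem Tset_eq_biUnion_Tsub (c : ℕ → ℂ) (T₀ T : ℝ) {j : ℕ} (hj : 2 ≤ j) :
    I.Tset c T₀ T j = ⋃ r ∈ I.blocks (j - 1), I.Tsub c T₀ T j r := by
  classical
  ext t
  simp only [Set.mem_iUnion, exists_prop]
  constructor
  · intro ht
    -- `t` is not good at level `j - 1`
    have hng : t ∉ I.goodSet c (j - 1) := by
      have h2 := ht.2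
      simp only [Set.mem_iInter, Set.mem_compl_iff] at h2
      exact h2 (j - 1) (mem_Ico.2 ⟨by omega, by omega⟩)
    have hex : ∃ r ∈ I.blocks (j - 1), t ∈ I.bigSet c (j - 1) r := by
      by_contra hall
      push Not at hall
      apply hng
      unfold goodSet
      simp only [Set.mem_iInter, Set.mem_setOf_eq]
      intro r hr
      have := hall r hr
      unfold bigSet at this
      simpa using this
    set s := (I.blocks (j - 1)).filter (fun r => t ∈ I.bigSet c (j - 1) r) with hs
    have hne : s.Nonempty := by
      obtain ⟨r, hr, hrt⟩ := hex
      exact ⟨r, mem_filter.2 ⟨hr, hrt⟩⟩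
    refine ⟨s.min' hne, (mem_filter.1 (s.min'_mem hne)).1, ?_⟩
    refine ⟨⟨ht, (mem_filter.1 (s.min'_mem hne)).2⟩, ?_⟩
    simp only [Set.mem_iInter, Set.mem_compl_iff]
    intro r' hr' hr't
    rw [mem_filter] at hr'
    have : s.min' hne ≤ r' := s.min'_le r' (mem_filter.2 ⟨hr'.1, hr't⟩)
    omega
  · rintro ⟨r, _, ht⟩
    exact ht.1.1

/-- Splitting an integral over `𝒯_j` along the `𝒯_{j,r}`. [folklore] -/
theorem integral_Tset_eq_sum_Tsub (c : ℕ → ℂ) (T₀ T : ℝ) {j : ℕ} (hj : 2 ≤ j) {g : ℝ → ℝ}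
    (hg : IntegrableOn g (I.Tset c T₀ T j)) :
    ∫ t in I.Tset c T₀ T j, g t = ∑ r ∈ I.blocks (j - 1), ∫ t in I.Tsub c T₀ T j r, g t := by
  conv_lhs => rw [I.Tset_eq_biUnion_Tsub c T₀ T hj]
  refine integral_biUnion_finset _ (fun r _ => I.measurableSet_Tsub c T₀ T j r) ?_
    (fun r _ => hg.mono_set (I.Tsub_subset c T₀ T j r))
  intro r hr r' hr' hne
  exact I.disjoint_Tsub c T₀ T j hr hr' hne

/-- **The amplification step** (§8.2: "On `𝒯_{j,r}` we have `|Q_{r,H_{j-1}}(1+it)| > e^{-α_{j-1} r/H_{j-1}}`.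
Therefore, for any `ℓ ≥ 1`, multiplying by `(|Q_{r,H_{j-1}}(1+it)| e^{α_{j-1} r/H_{j-1}})^{2ℓ} ≥ 1`, …"):
on `𝒯_{j,r}`, `|R|² ≤ e^{2ℓ α_{j-1} r/H_{j-1}} |Q_{r,H_{j-1}}^ℓ R|²` for every `R` and `ℓ`.
[cite: MatomakiRadziwillAnnals2016, §8.2] -/
theorem norm_sq_le_on_Tsub (c : ℕ → ℂ) (T₀ T : ℝ) {j r : ℕ} {t : ℝ} (ht : t ∈ I.Tsub c T₀ T j r)
    (R : ℂ) (ℓ : ℕ) :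
    ‖R‖ ^ 2 ≤ Real.exp (2 * ℓ * (alpha η (j - 1) * r / I.Hpar (j - 1))) *
      ‖blockPrimePoly c (I.P (j - 1)) (I.Q (j - 1)) (I.Hpar (j - 1)) r t ^ ℓ * R‖ ^ 2 := by
  have hbig : Real.exp (-(alpha η (j - 1) * r / I.Hpar (j - 1))) <
      ‖blockPrimePoly c (I.P (j - 1)) (I.Q (j - 1)) (I.Hpar (j - 1)) r t‖ := ht.1.2
  set a := alpha η (j - 1) * r / I.Hpar (j - 1) with ha
  set q := ‖blockPrimePoly c (I.P (j - 1)) (I.Q (j - 1)) (I.Hpar (j - 1)) r t‖ with hq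
  have hq0 : 0 ≤ q := norm_nonneg _
  -- `1 ≤ q e^{a}`, hence `1 ≤ (q e^a)^{2ℓ} = e^{2ℓ a} q^{2ℓ}`
  have h1 : 1 ≤ q * Real.exp a := by
    have : Real.exp (-a) * Real.exp a = 1 := by rw [← Real.exp_add]; simp
    rw [← this]
    exact mul_le_mul_of_nonneg_right hbig.le (Real.exp_pos a).le
  have h2 : 1 ≤ (q * Real.exp a) ^ (2 * ℓ) := one_le_pow₀ h1
  rw [norm_mul, norm_pow, mul_pow, ← pow_mul, ← hq]
  have hexp : Real.exp (2 * ℓ * a) = Real.exp a ^ (2 * ℓ) := by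
    rw [← Real.exp_nat_mul]; congr 1; push_cast; ring
  rw [hexp, mul_comm ℓ 2]
  calc ‖R‖ ^ 2 = 1 * ‖R‖ ^ 2 := (one_mul _).symm
    _ ≤ (q * Real.exp a) ^ (2 * ℓ) * ‖R‖ ^ 2 := mul_le_mul_of_nonneg_right h2 (sq_nonneg _)
    _ = Real.exp a ^ (2 * ℓ) * (q ^ (2 * ℓ) * ‖R‖ ^ 2) := by rw [mul_pow]; ring

/-! ### Matching Lemma 13 -/

/-- For `H ≥ 2` the prime block `[e^{r/H}, e^{(r+1)/H})` lies inside `[Y₁, 2Y₁]`, `Y₁ = e^{r/H}`, so the block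
polynomial `Q_{r,H}` is a Lemma-13 polynomial `∑_{Y₁ ≤ p ≤ 2Y₁} c'_p p^{-s}` with `c'_p = c_p 1_{block}(p)`.
[folklore] -/
theorem blockPrimePoly_eq_sum_Icc (c : ℕ → ℂ) (P Q : ℝ) {H : ℝ} (hH : 2 ≤ H) (r : ℕ) (t : ℝ) :
    blockPrimePoly c P Q H r t =
      ∑ p ∈ (Icc ⌈Real.exp ((r : ℝ) / H)⌉₊ ⌊2 * Real.exp ((r : ℝ) / H)⌋₊).filter Nat.Prime,
        (if p ∈ ((Icc ⌈P⌉₊ ⌊Q⌋₊).filter Nat.Prime).filter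
            (fun p : ℕ => Real.exp (r / H) ≤ p ∧ (p : ℝ) < Real.exp ((r + 1) / H)) then c p else 0) *
          (p : ℂ) ^ (-(1 + (t : ℂ) * Complex.I)) := by
  have hH0 : 0 < H := by linarith
  -- the block is contained in the primes of `[Y₁, 2Y₁]`
  have hsub : ((Icc ⌈P⌉₊ ⌊Q⌋₊).filter Nat.Prime).filter
      (fun p : ℕ => Real.exp (r / H) ≤ p ∧ (p : ℝ) < Real.exp ((r + 1) / H)) ⊆
      (Icc ⌈Real.exp ((r : ℝ) / H)⌉₊ ⌊2 * Real.exp ((r : ℝ) / H)⌋₊).filter Nat.Prime := by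
    intro p hp
    rw [mem_filter, mem_filter] at hp
    rw [mem_filter, mem_Icc]
    refine ⟨⟨Nat.ceil_le.2 hp.2.1, Nat.le_floor ?_⟩, hp.1.2⟩
    have he : Real.exp (1 / H) ≤ 2 := by
      have h1 : Real.exp (1 / H) ≤ Real.exp (1 / 2) :=
        Real.exp_le_exp.2 (by rw [div_le_div_iff₀ hH0 two_pos]; linarith)
      have h2 : Real.exp (1 / 2) * Real.exp (1 / 2) = Real.exp 1 := by rw [← Real.exp_add]; norm_num
      nlinarith [Real.exp_pos (1 / 2), Real.exp_one_lt_three.le, Real.add_one_le_exp (1 / 2 : ℝ)]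
    have : Real.exp (((r : ℝ) + 1) / H) = Real.exp ((r : ℝ) / H) * Real.exp (1 / H) := by
      rw [← Real.exp_add]; congr 1; ring
    have h3 := hp.2.2.le
    rw [this] at h3
    calc (p : ℝ) ≤ Real.exp ((r : ℝ) / H) * Real.exp (1 / H) := h3
      _ ≤ Real.exp ((r : ℝ) / H) * 2 := mul_le_mul_of_nonneg_left he (Real.exp_pos _).le
      _ = 2 * Real.exp ((r : ℝ) / H) := by ring
  unfold blockPrimePoly
  symm
  rw [← sum_subset hsub]
  · exact sum_congr rfl fun p hp => by rw [if_pos hp]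
  · intro p _ hp
    rw [if_neg hp, zero_mul]

/-- The cofactor polynomial `R_{v,H}` is a Lemma-13 polynomial `A(s) = ∑_{X/Y₂ ≤ m ≤ 2X/Y₂} a_m m^{-s}` with
`Y₂ = e^{v/H}`, `a_m = b_m/(ω(m)+1)`. [folklore] -/
theorem blockCofactorPoly_eq_sum_Icc (b : ℕ → ℂ) (X P Q H : ℝ) (v : ℕ) (t : ℝ) :
    blockCofactorPoly b X P Q H v t =
      ∑ m ∈ Icc ⌈X / Real.exp ((v : ℝ) / H)⌉₊ ⌊2 * X / Real.exp ((v : ℝ) / H)⌋₊,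
        (b m * ((1 : ℂ) / ((primeDivisorsIn P Q m : ℂ) + 1))) * (m : ℂ) ^ (-(1 + (t : ℂ) * Complex.I)) := by
  unfold blockCofactorPoly
  rw [Real.exp_neg, div_eq_mul_inv X, div_eq_mul_inv (2 * X)]
  exact sum_congr rfl fun m _ => by ring

/-- **Lemma 13 for `(Q_{r,H_{j-1}})^ℓ R_{v,H_j}`**: with `C₁₃` the constant of `MatomakiRadziwill2016_lemma13`,
`Y₁ = e^{r/H_{j-1}} ≥ 2`, `ℓ = ⌈(v/H_j)/(r/H_{j-1})⌉`, `H_{j-1} ≥ 2`, `X, T ≥ 1`, `|b|, |c| ≤ 1`: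
`∫_{-T}^{T} |Q_{r,H_{j-1}}(1+it)^ℓ R_{v,H_j}(1+it)|² dt ≤ C₁₃ (T/X + 2^ℓ Y₁) ((ℓ+1)!)²`.
[cite: MatomakiRadziwillAnnals2016, Lemma 13 and §8.2] -/
theorem lemma13_block {C₁₃ : ℝ}
    (h13 : ∀ (X T Y₁ Y₂ : ℝ) (a c : ℕ → ℂ), 1 ≤ X → 1 ≤ T → 2 ≤ Y₁ → 1 ≤ Y₂ →
      (∀ m, ‖a m‖ ≤ 1) → (∀ p, ‖c p‖ ≤ 1) →
      ∫ t in (-T)..T,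
          ‖(∑ p ∈ (Icc ⌈Y₁⌉₊ ⌊2 * Y₁⌋₊).filter Nat.Prime, c p * (p : ℂ) ^ (-(1 + (t : ℂ) * Complex.I)))
                ^ ⌈Real.log Y₂ / Real.log Y₁⌉₊
            * ∑ m ∈ Icc ⌈X / Y₂⌉₊ ⌊2 * X / Y₂⌋₊, a m * (m : ℂ) ^ (-(1 + (t : ℂ) * Complex.I))‖ ^ 2 ≤
        C₁₃ * (T / X + 2 ^ ⌈Real.log Y₂ / Real.log Y₁⌉₊ * Y₁)
          * ((⌈Real.log Y₂ / Real.log Y₁⌉₊ + 1).factorial : ℝ) ^ 2)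
    {b c : ℕ → ℂ} (hb : ∀ m, ‖b m‖ ≤ 1) (hc : ∀ p, ‖c p‖ ≤ 1) (hX : 1 ≤ X) {T : ℝ} (hT : 1 ≤ T)
    (P Q P' Q' : ℝ) {H : ℝ} (hH : 2 ≤ H) {Hv : ℝ} (hHv : 0 < Hv) (r v : ℕ)
    (hY₁ : 2 ≤ Real.exp ((r : ℝ) / H)) :
    ∫ t in (-T)..T, ‖blockPrimePoly c P Q H r t ^ ⌈((v : ℝ) / Hv) / ((r : ℝ) / H)⌉₊ *
        blockCofactorPoly b X P' Q' Hv v t‖ ^ 2 ≤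
      C₁₃ * (T / X + 2 ^ ⌈((v : ℝ) / Hv) / ((r : ℝ) / H)⌉₊ * Real.exp ((r : ℝ) / H)) *
        ((⌈((v : ℝ) / Hv) / ((r : ℝ) / H)⌉₊ + 1).factorial : ℝ) ^ 2 := by
  have hY₂ : 1 ≤ Real.exp ((v : ℝ) / Hv) := Real.one_le_exp (by positivity)
  have h := h13 X T (Real.exp ((r : ℝ) / H)) (Real.exp ((v : ℝ) / Hv))
    (fun m => b m * ((1 : ℂ) / ((primeDivisorsIn P' Q' m : ℂ) + 1)))
    (fun p => if p ∈ ((Icc ⌈P⌉₊ ⌊Q⌋₊).filter Nat.Prime).filter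
        (fun p : ℕ => Real.exp (r / H) ≤ p ∧ (p : ℝ) < Real.exp ((r + 1) / H)) then c p else 0)
    hX hT hY₁ hY₂ ?_ ?_
  · rw [Real.log_exp, Real.log_exp] at h
    simp_rw [blockPrimePoly_eq_sum_Icc c P Q hH r, blockCofactorPoly_eq_sum_Icc b X P' Q' Hv v]
    exact h
  · intro m
    rw [norm_mul, MatomakiRadziwillLemma12.norm_wt]
    have h2 : 1 / ((primeDivisorsIn P' Q' m : ℝ) + 1) ≤ 1 := by
      rw [div_le_one (by positivity)]
      linarith [(Nat.cast_nonneg (primeDivisorsIn P' Q' m) : (0:ℝ) ≤ _)]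
    exact mul_le_one₀ (hb m) (by positivity) h2
  · intro p
    split_ifs
    · exact hc p
    · simp

/-! ### The exponent bookkeeping of §8.2 -/

/-- `2^ℓ ((ℓ+1)!)² ≤ exp(ℓ log 2 + 2(ℓ+1) log(ℓ+1))` (`(ℓ+1)! ≤ (ℓ+1)^{ℓ+1}`). [folklore] -/
theorem two_pow_mul_factorial_sq_le (ℓ : ℕ) :
    (2 : ℝ) ^ ℓ * (((ℓ + 1).factorial : ℕ) : ℝ) ^ 2 ≤
      Real.exp (ℓ * Real.log 2 + 2 * ((ℓ : ℝ) + 1) * Real.log ((ℓ : ℝ) + 1)) := by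
  have h2 : (2 : ℝ) ^ ℓ = Real.exp (ℓ * Real.log 2) := by
    rw [Real.exp_nat_mul, Real.exp_log two_pos]
  have hf : (((ℓ + 1).factorial : ℕ) : ℝ) ≤ Real.exp (((ℓ : ℝ) + 1) * Real.log ((ℓ : ℝ) + 1)) := by
    have h1 : ((ℓ + 1).factorial : ℝ) ≤ ((ℓ + 1 : ℕ) : ℝ) ^ (ℓ + 1) := by
      exact_mod_cast Nat.factorial_le_pow (ℓ + 1)
    have h3 : ((ℓ + 1 : ℕ) : ℝ) ^ (ℓ + 1) = Real.exp (((ℓ : ℝ) + 1) * Real.log ((ℓ : ℝ) + 1)) := by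
      rw [show ((ℓ : ℝ) + 1) = ((ℓ + 1 : ℕ) : ℝ) by push_cast; ring, Real.exp_nat_mul,
        Real.exp_log (by positivity)]
    rw [← h3]; exact h1
  have hf0 : (0 : ℝ) ≤ ((ℓ + 1).factorial : ℕ) := by positivity
  calc (2 : ℝ) ^ ℓ * (((ℓ + 1).factorial : ℕ) : ℝ) ^ 2
      ≤ Real.exp (ℓ * Real.log 2) * (Real.exp (((ℓ : ℝ) + 1) * Real.log ((ℓ : ℝ) + 1))) ^ 2 := by
        rw [h2]
        exact mul_le_mul_of_nonneg_left (pow_le_pow_left₀ hf0 hf 2) (Real.exp_pos _).le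
    _ = Real.exp (ℓ * Real.log 2 + 2 * ((ℓ : ℝ) + 1) * Real.log ((ℓ : ℝ) + 1)) := by
        rw [sq, ← Real.exp_add, ← Real.exp_add]; congr 1; ring

/-- `2α_{j-1} - 2α_j = -η/(j(j-1))` for `j ≥ 2`. [folklore] -/
theorem two_alpha_sub (η : ℝ) {j : ℕ} (hj : 2 ≤ j) :
    2 * alpha η (j - 1) - 2 * alpha η j = -(η / ((j : ℝ) * ((j : ℝ) - 1))) := by
  unfold alpha
  have hj1 : ((j - 1 : ℕ) : ℝ) = (j : ℝ) - 1 := by rw [Nat.cast_sub (by omega)]; simp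
  rw [hj1]
  have hj0 : (j : ℝ) - 1 ≠ 0 := by
    have : (2 : ℝ) ≤ j := by exact_mod_cast hj
    linarith
  have hj0' : (j : ℝ) ≠ 0 := by
    have : (2 : ℝ) ≤ j := by exact_mod_cast hj
    linarith
  field_simp
  ring

/-- `0 < α_i ≤ 1/4` for `i ≥ 1` and `0 < η < 1/6`. [folklore] -/
theorem alpha_pos (hη : 0 < η) (hη6 : η < 1 / 6) {i : ℕ} (hi : 1 ≤ i) :
    0 < alpha η i ∧ alpha η i ≤ 1 / 4 := by
  unfold alpha
  have hi1 : (1 : ℝ) ≤ i := by exact_mod_cast hi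
  have h1 : 1 / (2 * (i : ℝ)) ≤ 1 / 2 := by
    rw [div_le_div_iff₀ (by positivity) two_pos]; linarith
  have h2 : 0 ≤ 1 / (2 * (i : ℝ)) := by positivity
  constructor
  · nlinarith
  · nlinarith

/-- **The exponent bookkeeping of §8.2.**  For `j ≥ 2`, `0 < η < 1/6`, `1 ≤ y₀ ≤ y ≤ x ≤ L`, `y ≤ L'`,
with `log L ≤ (η/(4j²)) y₀` (condition (2), `y₀ = log P_{j-1} - 1`, `L = log Q_j`) and `4/y₀ ≤ η/(j²(j-1))`
(`loglogQ_ge`), and `ℓ = ⌈x/y⌉`: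
`e^{-2α_j x} e^{2ℓ α_{j-1} y} 2^ℓ ((ℓ+1)!)² ≤ e^{-(η/(2j²)) x} e^{L'/2} L⁴ e⁶`
(the paper: "`≪ exp(2v(α_{j-1} - α_j)/H_j + 2α_{j-1} r/H_{j-1}) ⋯ exp(2ℓ log ℓ)`,
`ℓ log ℓ ≤ (v/H_j) (log log Q_j)/(log P_{j-1} - 1) + log log Q_j + 1`", with `x = v/H_j`, `y = r/H_{j-1}`).
[cite: MatomakiRadziwillAnnals2016, §8.2] -/
theorem exponent_bound (hη : 0 < η) (hη6 : η < 1 / 6) {j : ℕ} (hj : 2 ≤ j) {x y y₀ L L' : ℝ}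
    (hy₀ : 1 ≤ y₀) (hy : y₀ ≤ y) (hyL : y ≤ L') (hxy : y ≤ x) (hxL : x ≤ L)
    (h2a : Real.log L ≤ η / (4 * (j : ℝ) ^ 2) * y₀)
    (h2b : 4 / y₀ ≤ η / ((j : ℝ) ^ 2 * ((j : ℝ) - 1))) :
    Real.exp (-(2 * alpha η j * x)) * Real.exp (2 * ⌈x / y⌉₊ * (alpha η (j - 1) * y)) *
        ((2 : ℝ) ^ ⌈x / y⌉₊ * (((⌈x / y⌉₊ + 1).factorial : ℕ) : ℝ) ^ 2) ≤
      Real.exp (-(η / (2 * (j : ℝ) ^ 2) * x)) * Real.exp (L' / 2) * L ^ 4 * Real.exp 6 := by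
  set ℓ := ⌈x / y⌉₊ with hℓdef
  have hj2 : (2 : ℝ) ≤ j := by exact_mod_cast hj
  have hy0 : 0 < y := by linarith
  have hx0 : 0 < x := by linarith
  have hL1 : 1 ≤ L := by linarith
  have hL0 : 0 < L := by linarith
  have hxy1 : 1 ≤ x / y := (one_le_div hy0).2 hxy
  have hℓ : (ℓ : ℝ) ≤ x / y + 1 := (Nat.ceil_lt_add_one (by positivity)).le
  have hℓ0 : (0 : ℝ) ≤ ℓ := Nat.cast_nonneg ℓ
  obtain ⟨hα'0, hα'⟩ := alpha_pos hη hη6 (show 1 ≤ j - 1 by omega)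
  have hαd := two_alpha_sub η hj
  -- `log(ℓ+1) ≤ log 3 + log L`
  have hlog3 : Real.log 3 < 1.2 := by
    have h1 : (3 : ℝ) < Real.exp 1.2 := by
      have := Real.add_one_le_exp (0.2 : ℝ)
      have h2 : Real.exp 1.2 = Real.exp 1 * Real.exp 0.2 := by rw [← Real.exp_add]; norm_num
      have h3 : (2.7 : ℝ) < Real.exp 1 := by linarith [Real.exp_one_gt_d9]
      nlinarith [Real.exp_pos (0.2:ℝ)]
    have := Real.log_lt_log (by norm_num) h1
    rwa [Real.log_exp] at this
  have hlog2 : Real.log 2 < 0.7 := by linarith [Real.log_two_lt_d9]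
  have hlogL : 0 ≤ Real.log L := Real.log_nonneg hL1
  have hlogℓ : Real.log ((ℓ : ℝ) + 1) ≤ Real.log 3 + Real.log L := by
    rw [← Real.log_mul (by norm_num) hL0.ne']
    apply Real.log_le_log (by positivity)
    have h1 : x / y ≤ x := div_le_self hx0.le (by linarith)
    linarith
  -- the three pieces of the exponent
  set M := Real.log 2 + 2 * (Real.log 3 + Real.log L) with hMdef
  have hM0 : 0 ≤ M := by
    have : 0 < Real.log 2 := Real.log_pos (by norm_num)
    have : 0 < Real.log 3 := Real.log_pos (by norm_num)
    positivity
  have hM : M ≤ 3.2 + 2 * Real.log L := by rw [hMdef]; linarith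
  -- (i) `2ℓα'y ≤ 2α'x + L'/2`
  have hi : 2 * ℓ * (alpha η (j - 1) * y) ≤ 2 * alpha η (j - 1) * x + L' / 2 := by
    have hℓy : (ℓ : ℝ) * y ≤ x + y := by
      have := mul_le_mul_of_nonneg_right hℓ hy0.le
      rwa [add_mul, div_mul_cancel₀ _ hy0.ne', one_mul] at this
    have : 2 * ℓ * (alpha η (j - 1) * y) = 2 * alpha η (j - 1) * (ℓ * y) := by ring
    rw [this]
    nlinarith
  -- (ii) `ℓ log 2 + 2(ℓ+1) log(ℓ+1) ≤ (x/y₀) M + M + 2.4 + 2 log L`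
  have hii : ℓ * Real.log 2 + 2 * ((ℓ : ℝ) + 1) * Real.log ((ℓ : ℝ) + 1) ≤
      x / y₀ * M + M + 2.4 + 2 * Real.log L := by
    have h1 : ℓ * Real.log 2 + 2 * ((ℓ : ℝ) + 1) * Real.log ((ℓ : ℝ) + 1) ≤ ℓ * M + 2 * (Real.log 3 + Real.log L) := by
      have hlogℓ0 : 0 ≤ Real.log ((ℓ : ℝ) + 1) := Real.log_nonneg (by linarith)
      have : 2 * ((ℓ : ℝ) + 1) * Real.log ((ℓ : ℝ) + 1) ≤ 2 * ((ℓ : ℝ) + 1) * (Real.log 3 + Real.log L) :=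
        mul_le_mul_of_nonneg_left hlogℓ (by positivity)
      rw [hMdef]
      nlinarith
    have h2 : (ℓ : ℝ) * M ≤ (x / y + 1) * M := mul_le_mul_of_nonneg_right hℓ hM0
    have h3 : x / y * M ≤ x / y₀ * M :=
      mul_le_mul_of_nonneg_right (div_le_div_of_nonneg_left hx0.le (by linarith) hy) hM0
    nlinarith
  -- (iii) the coefficient of `x`: `2α' - 2α_j + M/y₀ ≤ -η/(2j²)`
  have hiii : (2 * alpha η (j - 1) - 2 * alpha η j) + M / y₀ ≤ -(η / (2 * (j : ℝ) ^ 2)) := by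
    have hMy : M / y₀ ≤ 3.2 / y₀ + 2 * (η / (4 * (j : ℝ) ^ 2)) := by
      have h1 : M / y₀ ≤ (3.2 + 2 * Real.log L) / y₀ := div_le_div_of_nonneg_right hM (by linarith)
      have h2 : (3.2 + 2 * Real.log L) / y₀ = 3.2 / y₀ + 2 * (Real.log L / y₀) := by ring
      have h3 : Real.log L / y₀ ≤ η / (4 * (j : ℝ) ^ 2) := by
        rw [div_le_iff₀ (by linarith)]; exact h2a
      linarith
    have h3y : 3.2 / y₀ ≤ 4 / 5 * (η / ((j : ℝ) ^ 2 * ((j : ℝ) - 1))) := by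
      have : 3.2 / y₀ = 4 / 5 * (4 / y₀) := by ring
      rw [this]
      exact mul_le_mul_of_nonneg_left h2b (by norm_num)
    rw [hαd]
    have hj1 : 0 < (j : ℝ) - 1 := by linarith
    have key : -(η / ((j : ℝ) * ((j : ℝ) - 1))) + 4 / 5 * (η / ((j : ℝ) ^ 2 * ((j : ℝ) - 1)))
        + 2 * (η / (4 * (j : ℝ) ^ 2)) + η / (2 * (j : ℝ) ^ 2) = -(η / (5 * (j : ℝ) ^ 2 * ((j : ℝ) - 1))) := by
      field_simp
      ring
    have hneg : -(η / (5 * (j : ℝ) ^ 2 * ((j : ℝ) - 1))) ≤ 0 := by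
      rw [neg_nonpos]; positivity
    linarith
  -- combine
  have hE : -(2 * alpha η j * x) + 2 * ℓ * (alpha η (j - 1) * y) +
      (ℓ * Real.log 2 + 2 * ((ℓ : ℝ) + 1) * Real.log ((ℓ : ℝ) + 1)) ≤
      -(η / (2 * (j : ℝ) ^ 2) * x) + L' / 2 + 4 * Real.log L + 6 := by
    have hx1 : x / y₀ * M = x * (M / y₀) := by ring
    have hcoefx : x * ((2 * alpha η (j - 1) - 2 * alpha η j) + M / y₀) ≤ x * (-(η / (2 * (j : ℝ) ^ 2))) :=
      mul_le_mul_of_nonneg_left hiii hx0.le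
    linarith only [hi, hii, hcoefx, hx1, hM]
  calc Real.exp (-(2 * alpha η j * x)) * Real.exp (2 * ℓ * (alpha η (j - 1) * y)) *
        ((2 : ℝ) ^ ℓ * (((ℓ + 1).factorial : ℕ) : ℝ) ^ 2)
      ≤ Real.exp (-(2 * alpha η j * x)) * Real.exp (2 * ℓ * (alpha η (j - 1) * y)) *
          Real.exp (ℓ * Real.log 2 + 2 * ((ℓ : ℝ) + 1) * Real.log ((ℓ : ℝ) + 1)) :=
        mul_le_mul_of_nonneg_left (two_pow_mul_factorial_sq_le ℓ) (by positivity)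
    _ = Real.exp (-(2 * alpha η j * x) + 2 * ℓ * (alpha η (j - 1) * y) +
          (ℓ * Real.log 2 + 2 * ((ℓ : ℝ) + 1) * Real.log ((ℓ : ℝ) + 1))) := by
        rw [← Real.exp_add, ← Real.exp_add]
    _ ≤ Real.exp (-(η / (2 * (j : ℝ) ^ 2) * x) + L' / 2 + 4 * Real.log L + 6) := Real.exp_le_exp.2 hE
    _ = Real.exp (-(η / (2 * (j : ℝ) ^ 2) * x)) * Real.exp (L' / 2) * L ^ 4 * Real.exp 6 := by
        rw [Real.exp_add, Real.exp_add, Real.exp_add]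
        congr 2
        rw [show (4 : ℝ) * Real.log L = ((4 : ℕ) : ℝ) * Real.log L by norm_num, Real.exp_nat_mul,
          Real.exp_log hL0]

/-! ### The integral over `𝒯_{j,r}` of `|Q_{v,H_j} R_{v,H_j}|²` -/

/-- **§8.2, analytic part**: for `j ≥ 2`, `r ∈ ℐ_{j-1}`, `v ∈ ℐ_j`, with `ℓ = ⌈(v/H_j)/(r/H_{j-1})⌉`,
`Y₁ = e^{r/H_{j-1}} ≥ 2`, `H_{j-1} ≥ 2`, `X, T ≥ 1`, `T₀ ≥ 0` and the constant `C₁₃` of Lemma 13: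
`∫_{𝒯_{j,r}} |Q_{v,H_j} R_{v,H_j}|² ≤ e^{-2α_j v/H_j} e^{2ℓ α_{j-1} r/H_{j-1}} · max(C₁₃,0) (T/X + 2^ℓ Y₁) ((ℓ+1)!)²`
("multiplying by `(|Q_{r,H_{j-1}}| e^{α_{j-1}r/H_{j-1}})^{2ℓ} ≥ 1` … Now we are in the position to use Lemma 13").
[cite: MatomakiRadziwillAnnals2016, §8.2] -/
theorem integral_Tsub_le {C₁₃ : ℝ}
    (h13 : ∀ (X T Y₁ Y₂ : ℝ) (a c : ℕ → ℂ), 1 ≤ X → 1 ≤ T → 2 ≤ Y₁ → 1 ≤ Y₂ →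
      (∀ m, ‖a m‖ ≤ 1) → (∀ p, ‖c p‖ ≤ 1) →
      ∫ t in (-T)..T,
          ‖(∑ p ∈ (Icc ⌈Y₁⌉₊ ⌊2 * Y₁⌋₊).filter Nat.Prime, c p * (p : ℂ) ^ (-(1 + (t : ℂ) * Complex.I)))
                ^ ⌈Real.log Y₂ / Real.log Y₁⌉₊
            * ∑ m ∈ Icc ⌈X / Y₂⌉₊ ⌊2 * X / Y₂⌋₊, a m * (m : ℂ) ^ (-(1 + (t : ℂ) * Complex.I))‖ ^ 2 ≤
        C₁₃ * (T / X + 2 ^ ⌈Real.log Y₂ / Real.log Y₁⌉₊ * Y₁)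
          * ((⌈Real.log Y₂ / Real.log Y₁⌉₊ + 1).factorial : ℝ) ^ 2)
    (f : ArithmeticFunction ℝ) (hf1 : ∀ n, |f n| ≤ 1) (hX : 1 ≤ X) {T₀ T : ℝ} (hT₀ : 0 ≤ T₀)
    (hT : 1 ≤ T) (j : ℕ) (hH : 2 ≤ I.Hpar (j - 1)) (hHj : 0 < I.Hpar j) {r v : ℕ}
    (hv : v ∈ I.blocks j) (hY₁ : 2 ≤ Real.exp ((r : ℝ) / I.Hpar (j - 1))) :
    ∫ t in I.Tsub (fun p => ((f p : ℝ) : ℂ)) T₀ T j r,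
        ‖blockPrimePoly (fun p => ((f p : ℝ) : ℂ)) (I.P j) (I.Q j) (I.Hpar j) v t *
          blockCofactorPoly (I.bCoef f j) X (I.P j) (I.Q j) (I.Hpar j) v t‖ ^ 2 ≤
      Real.exp (-(2 * alpha η j * ((v : ℝ) / I.Hpar j))) *
        Real.exp (2 * ⌈((v : ℝ) / I.Hpar j) / ((r : ℝ) / I.Hpar (j - 1))⌉₊ *
          (alpha η (j - 1) * ((r : ℝ) / I.Hpar (j - 1)))) *
        (max C₁₃ 0 * (T / X + 2 ^ ⌈((v : ℝ) / I.Hpar j) / ((r : ℝ) / I.Hpar (j - 1))⌉₊ *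
            Real.exp ((r : ℝ) / I.Hpar (j - 1))) *
          ((⌈((v : ℝ) / I.Hpar j) / ((r : ℝ) / I.Hpar (j - 1))⌉₊ + 1).factorial : ℝ) ^ 2) := by
  set c : ℕ → ℂ := fun p => ((f p : ℝ) : ℂ) with hcdef
  set ℓ := ⌈((v : ℝ) / I.Hpar j) / ((r : ℝ) / I.Hpar (j - 1))⌉₊ with hℓdef
  set Qv : ℝ → ℂ := fun t => blockPrimePoly c (I.P j) (I.Q j) (I.Hpar j) v t with hQv
  set Rv : ℝ → ℂ := fun t => blockCofactorPoly (I.bCoef f j) X (I.P j) (I.Q j) (I.Hpar j) v t with hRv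
  set Qr : ℝ → ℂ := fun t => blockPrimePoly c (I.P (j - 1)) (I.Q (j - 1)) (I.Hpar (j - 1)) r t with hQr
  set e₁ := Real.exp (-(2 * alpha η j * ((v : ℝ) / I.Hpar j))) with he₁
  set e₂ := Real.exp (2 * ℓ * (alpha η (j - 1) * ((r : ℝ) / I.Hpar (j - 1)))) with he₂
  have hT0 : 0 < T := by linarith
  have hsubT : I.Tsub c T₀ T j r ⊆ Set.Icc (-T) T :=
    ((I.Tsub_subset c T₀ T j r).trans (I.Tset_subset c T₀ T j)).trans
      (Set.Icc_subset_Icc (by linarith) le_rfl)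
  -- pointwise bound on `𝒯_{j,r}`
  have hpt : ∀ t ∈ I.Tsub c T₀ T j r, ‖Qv t * Rv t‖ ^ 2 ≤ e₁ * e₂ * ‖Qr t ^ ℓ * Rv t‖ ^ 2 := by
    intro t ht
    have hgood : t ∈ I.goodSet c j := (I.Tsub_subset c T₀ T j r ht).1.2
    have hQv1 : ‖Qv t‖ ≤ Real.exp (-(alpha η j * v / I.Hpar j)) := by
      unfold goodSet at hgood
      exact Set.mem_iInter₂.1 hgood v hv
    have hamp := I.norm_sq_le_on_Tsub c T₀ T ht (Rv t) ℓ
    have he₂' : Real.exp (2 * ℓ * (alpha η (j - 1) * r / I.Hpar (j - 1))) = e₂ := by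
      rw [he₂, mul_div_assoc]
    rw [he₂'] at hamp
    have he₁' : Real.exp (-(alpha η j * v / I.Hpar j)) ^ 2 = e₁ := by
      rw [he₁, ← Real.exp_nat_mul]; congr 1; push_cast; ring
    rw [norm_mul, mul_pow]
    calc ‖Qv t‖ ^ 2 * ‖Rv t‖ ^ 2 ≤ Real.exp (-(alpha η j * v / I.Hpar j)) ^ 2 * (e₂ * ‖Qr t ^ ℓ * Rv t‖ ^ 2) :=
          mul_le_mul (pow_le_pow_left₀ (norm_nonneg _) hQv1 2) hamp (sq_nonneg _) (sq_nonneg _)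
      _ = e₁ * e₂ * ‖Qr t ^ ℓ * Rv t‖ ^ 2 := by rw [he₁']; ring
  -- continuity / integrability
  have hcQv : Continuous Qv := by
    rw [hQv]; unfold blockPrimePoly; exact MatomakiRadziwillLemma12.continuous_dsum _ _
  have hcQr : Continuous Qr := by
    rw [hQr]; unfold blockPrimePoly; exact MatomakiRadziwillLemma12.continuous_dsum _ _
  have hcRv : Continuous Rv := by
    rw [hRv]; unfold blockCofactorPoly
    exact continuous_finsetSum _ fun m _ =>
      (continuous_const.mul (MatomakiRadziwillLemma12.continuous_cpw m)).div_const _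
  have hcG : Continuous fun t => ‖Qr t ^ ℓ * Rv t‖ ^ 2 := ((hcQr.pow ℓ).mul hcRv).norm.pow 2
  have hi1 : IntegrableOn (fun t => ‖Qv t * Rv t‖ ^ 2) (I.Tsub c T₀ T j r) :=
    MatomakiRadziwillLemma12.integrableOn_of_continuous ((hcQv.mul hcRv).norm.pow 2) hsubT
  have hi2 : IntegrableOn (fun t => e₁ * e₂ * ‖Qr t ^ ℓ * Rv t‖ ^ 2) (I.Tsub c T₀ T j r) :=
    MatomakiRadziwillLemma12.integrableOn_of_continuous (continuous_const.mul hcG) hsubT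
  -- Lemma 13
  have hL13 := lemma13_block h13 (I.norm_bCoef_le hf1 j) (norm_cCoef_le hf1) hX hT
    (I.P (j - 1)) (I.Q (j - 1)) (I.P j) (I.Q j) hH hHj r v hY₁
  have hmax : C₁₃ * (T / X + 2 ^ ℓ * Real.exp ((r : ℝ) / I.Hpar (j - 1))) *
      ((ℓ + 1).factorial : ℝ) ^ 2 ≤
      max C₁₃ 0 * (T / X + 2 ^ ℓ * Real.exp ((r : ℝ) / I.Hpar (j - 1))) *
        ((ℓ + 1).factorial : ℝ) ^ 2 := by
    have h0 : 0 ≤ (T / X + 2 ^ ℓ * Real.exp ((r : ℝ) / I.Hpar (j - 1))) *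
        ((ℓ + 1).factorial : ℝ) ^ 2 := by positivity
    have := mul_le_mul_of_nonneg_right (le_max_left C₁₃ 0) h0
    simpa [mul_assoc] using this
  calc ∫ t in I.Tsub c T₀ T j r, ‖Qv t * Rv t‖ ^ 2
      ≤ ∫ t in I.Tsub c T₀ T j r, e₁ * e₂ * ‖Qr t ^ ℓ * Rv t‖ ^ 2 :=
        setIntegral_mono_on hi1 hi2 (I.measurableSet_Tsub c T₀ T j r) hpt
    _ = e₁ * e₂ * ∫ t in I.Tsub c T₀ T j r, ‖Qr t ^ ℓ * Rv t‖ ^ 2 := integral_const_mul _ _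
    _ ≤ e₁ * e₂ * ∫ t in (-T)..T, ‖Qr t ^ ℓ * Rv t‖ ^ 2 :=
        mul_le_mul_of_nonneg_left
          (MatomakiRadziwillLemma12.setIntegral_le_intervalIntegral hcG (fun t => by positivity) hT0 hsubT)
          (by positivity)
    _ ≤ e₁ * e₂ * (max C₁₃ 0 * (T / X + 2 ^ ℓ * Real.exp ((r : ℝ) / I.Hpar (j - 1))) *
          ((ℓ + 1).factorial : ℝ) ^ 2) :=
        mul_le_mul_of_nonneg_left (hL13.trans hmax) (by positivity)

/-- rpow bookkeeping: `A · A^{1/2} · A^{4/96} · (A⁴)⁻¹ = A^{-59/24}` for `A > 0`. [folklore] -/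
theorem rpow_aux {A : ℝ} (hA : 0 < A) :
    A * (A ^ (1 / 2 : ℝ) * A ^ (4 / 96 : ℝ)) * (A ^ 4)⁻¹ = A ^ (-(59 / 24) : ℝ) := by
  rw [← Real.rpow_natCast A 4, ← Real.rpow_neg hA.le, ← Real.rpow_add hA,
    show A * (A ^ (1 / 2 + 4 / 96 : ℝ)) = A ^ (1 : ℝ) * A ^ (1 / 2 + 4 / 96 : ℝ) by rw [Real.rpow_one],
    ← Real.rpow_add hA, ← Real.rpow_add hA]
  norm_num

/-- **§8.2, the bound for one pair `(r, v)`**: for `j ≥ 2`, `0 < η < 1/6`, `H₁ ≥ 2`, `r ∈ ℐ_{j-1}`,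
`v ∈ ℐ_j`, `X, T ≥ 1`, `T₀ ≥ 0`:
`∫_{𝒯_{j,r}} |Q_{v,H_j} R_{v,H_j}|² ≤ max(C₁₃,0) (T/X + 1) e⁷ j^{-8} Q_{j-1}^{-59/24}`
(the printed chain `≪ (T/X + 1) Q_{j-1} (log Q_j)² exp((η/(2j²)) v/H_j)` for the moment, times
`exp(2v(α_{j-1}-α_j)/H_j + 2α_{j-1} r/H_{j-1})`, made explicit with `exponent_bound`, (2) and (3)).
[cite: MatomakiRadziwillAnnals2016, §8.2] -/
theorem integral_Tsub_le' {C₁₃ : ℝ}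
    (h13 : ∀ (X T Y₁ Y₂ : ℝ) (a c : ℕ → ℂ), 1 ≤ X → 1 ≤ T → 2 ≤ Y₁ → 1 ≤ Y₂ →
      (∀ m, ‖a m‖ ≤ 1) → (∀ p, ‖c p‖ ≤ 1) →
      ∫ t in (-T)..T,
          ‖(∑ p ∈ (Icc ⌈Y₁⌉₊ ⌊2 * Y₁⌋₊).filter Nat.Prime, c p * (p : ℂ) ^ (-(1 + (t : ℂ) * Complex.I)))
                ^ ⌈Real.log Y₂ / Real.log Y₁⌉₊
            * ∑ m ∈ Icc ⌈X / Y₂⌉₊ ⌊2 * X / Y₂⌋₊, a m * (m : ℂ) ^ (-(1 + (t : ℂ) * Complex.I))‖ ^ 2 ≤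
        C₁₃ * (T / X + 2 ^ ⌈Real.log Y₂ / Real.log Y₁⌉₊ * Y₁)
          * ((⌈Real.log Y₂ / Real.log Y₁⌉₊ + 1).factorial : ℝ) ^ 2)
    (hη : 0 < η) (hη6 : η < 1 / 6) (f : ArithmeticFunction ℝ) (hf1 : ∀ n, |f n| ≤ 1) (hX : 1 ≤ X)
    {T₀ T : ℝ} (hT₀ : 0 ≤ T₀) (hT : 1 ≤ T) {j : ℕ} (hj : 2 ≤ j) (hH1 : 2 ≤ I.Hpar 1)
    {r v : ℕ} (hr : r ∈ I.blocks (j - 1)) (hv : v ∈ I.blocks j) :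
    ∫ t in I.Tsub (fun p => ((f p : ℝ) : ℂ)) T₀ T j r,
        ‖blockPrimePoly (fun p => ((f p : ℝ) : ℂ)) (I.P j) (I.Q j) (I.Hpar j) v t *
          blockCofactorPoly (I.bCoef f j) X (I.P j) (I.Q j) (I.Hpar j) v t‖ ^ 2 ≤
      max C₁₃ 0 * (T / X + 1) * (Real.exp 7 / (j : ℝ) ^ 8 * I.Q (j - 1) ^ (-(59 / 24) : ℝ)) := by
  have hη' : η ≤ 8 := by linarith
  have hη'' : η ≤ 1 / 6 := hη6.le
  have hj1 : 1 ≤ j - 1 := by omega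
  have hj2 : (2 : ℝ) ≤ j := by exact_mod_cast hj
  -- sizes of the parameters
  have hHi : 2 ≤ I.Hpar (j - 1) := hH1.trans (I.Hpar_one_le hη hη' hj1)
  have hHi0 : 0 < I.Hpar (j - 1) := by linarith
  have hHj1 : 1 ≤ I.Hpar j := by linarith [I.Hpar_one_le hη hη' (show 1 ≤ j by omega)]
  have hHj0 : 0 < I.Hpar j := by linarith
  have hA : 0 < I.Q (j - 1) := I.pos_Q hj1
  have hA1 : 1 ≤ I.Q (j - 1) := I.one_le_Q hη hη' hj1
  have hlogA : 1 < Real.log (I.Q (j - 1)) := I.one_lt_logQ hη hη'' hj1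
  have hPj : 0 < I.P j := I.pos_P j (by omega)
  have hlogPi : 2 ≤ Real.log (I.P (j - 1)) := I.two_le_logP hη hη'' hj1
  have hX0 : 0 < X := by linarith
  have hT0 : 0 < T := by linarith
  -- `x = v/H_j`, `y = r/H_{j-1}`, `y₀ = log P_{j-1} - 1`, `L = log Q_j`, `L' = log Q_{j-1}`
  set x := (v : ℝ) / I.Hpar j with hx
  set y := (r : ℝ) / I.Hpar (j - 1) with hy
  have hy₀y : Real.log (I.P (j - 1)) - 1 ≤ y := by
    have h := I.Hpar_mul_log_P_lt hr
    rw [hy, le_div_iff₀ hHi0]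
    have hid : (Real.log (I.P (j - 1)) - 1) * I.Hpar (j - 1) =
        I.Hpar (j - 1) * Real.log (I.P (j - 1)) - I.Hpar (j - 1) := by ring
    linarith only [h, hid, hHi]
  have hyL' : y ≤ Real.log (I.Q (j - 1)) := by
    have hlogQ : 0 ≤ I.Hpar (j - 1) * Real.log (I.Q (j - 1)) := by positivity
    have hr' : (r : ℝ) ≤ I.Hpar (j - 1) * Real.log (I.Q (j - 1)) :=
      (Nat.le_floor_iff hlogQ).1 (mem_Icc.1 (by unfold blocks at hr; exact hr)).2
    rw [hy, div_le_iff₀ hHi0]; linarith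
  have hxL : x ≤ Real.log (I.Q j) := by
    have hlogQj : 0 ≤ Real.log (I.Q j) := (I.one_lt_logQ hη hη'' (by omega)).le.trans' zero_le_one
    have hlogQ : 0 ≤ I.Hpar j * Real.log (I.Q j) := by positivity
    have hv' : (v : ℝ) ≤ I.Hpar j * Real.log (I.Q j) :=
      (Nat.le_floor_iff hlogQ).1 (mem_Icc.1 (by unfold blocks at hv; exact hv)).2
    rw [hx, div_le_iff₀ hHj0]; linarith
  have hxP : Real.log (I.P j) - 1 ≤ x := by
    have h := I.Hpar_mul_log_P_lt hv
    rw [hx, le_div_iff₀ hHj0]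
    have hid : (Real.log (I.P j) - 1) * I.Hpar j = I.Hpar j * Real.log (I.P j) - I.Hpar j := by ring
    linarith only [h, hid, hHj1]
  have hyx : y ≤ x := by
    -- `log P_j ≥ (8j²/η) log Q_{j-1} ≥ log Q_{j-1} + 1`
    have h3 := I.notTooClose j hj
    have hlogj : 0 ≤ Real.log (j : ℝ) := Real.log_nonneg (by linarith)
    have hj4 : (4 : ℝ) ≤ (j : ℝ) ^ 2 := by nlinarith only [hj2]
    have hc : η / (j : ℝ) ^ 2 ≤ 1 := by
      rw [div_le_one (by positivity)]; linarith only [hη6, hj4]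
    have hlogPj : 0 < Real.log (I.P j) := by
      have : 0 < η / (j : ℝ) ^ 2 * Real.log (I.P j) := by linarith only [h3, hlogA, hlogj]
      exact pos_of_mul_pos_right this (by positivity)
    have : 8 * Real.log (I.Q (j - 1)) ≤ Real.log (I.P j) := by
      calc 8 * Real.log (I.Q (j - 1)) ≤ η / (j : ℝ) ^ 2 * Real.log (I.P j) := by
            linarith only [h3, hlogj]
        _ ≤ 1 * Real.log (I.P j) := mul_le_mul_of_nonneg_right hc hlogPj.le
        _ = Real.log (I.P j) := one_mul _
    linarith
  -- the exponent bookkeeping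
  have hexp := exponent_bound hη hη6 hj (by linarith) hy₀y hyL' hyx hxL (I.notTooFar j hj)
    (I.four_div_logP_sub_one_le hη hη'' hj)
  -- the analytic bound
  have hY₁ : 2 ≤ Real.exp y := by
    have : Real.log 2 ≤ y := by
      have := Real.log_two_lt_d9
      linarith
    calc (2 : ℝ) = Real.exp (Real.log 2) := (Real.exp_log two_pos).symm
      _ ≤ Real.exp y := Real.exp_le_exp.2 this
  have hmain := I.integral_Tsub_le h13 f hf1 hX hT₀ hT j hHi hHj0 hv hY₁
  -- sizes: `e^y ≤ Q_{j-1}`, `e^{L'/2} = Q_{j-1}^{1/2}`, `L⁴ ≤ Q_{j-1}^{4/96}`, `e^{-(η/2j²)x} ≤ e^{1/48}/(Q_{j-1}⁴ j⁸)`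
  have hey : Real.exp y ≤ I.Q (j - 1) := I.exp_div_Hpar_le hη hη' hj1 hr hHi0
  have heL' : Real.exp (Real.log (I.Q (j - 1)) / 2) = I.Q (j - 1) ^ (1 / 2 : ℝ) := by
    rw [Real.rpow_def_of_pos hA]; congr 1; ring
  have hL4 : Real.log (I.Q j) ^ 4 ≤ I.Q (j - 1) ^ (4 / 96 : ℝ) := by
    have h := I.logQ_le_Q_pred_rpow hη hη'' hj
    have h0 : 0 ≤ Real.log (I.Q j) := by linarith [hyx.trans hxL, hy₀y]
    calc Real.log (I.Q j) ^ 4 ≤ (I.Q (j - 1) ^ (1 / 96 : ℝ)) ^ 4 := pow_le_pow_left₀ h0 h 4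
      _ = I.Q (j - 1) ^ (4 / 96 : ℝ) := by
          rw [← Real.rpow_natCast, ← Real.rpow_mul hA.le]; norm_num
  have hex : Real.exp (-(η / (2 * (j : ℝ) ^ 2) * x)) ≤ Real.exp (1 / 48) * ((I.Q (j - 1) ^ 4 * (j : ℝ) ^ 8))⁻¹ := by
    have h3 := I.Q_pow_four_mul_le hη hj
    have hj4 : (4 : ℝ) ≤ (j : ℝ) ^ 2 := by nlinarith only [hj2]
    have hc : η / (2 * (j : ℝ) ^ 2) ≤ 1 / 48 := by
      rw [div_le_div_iff₀ (by positivity) (by norm_num)]; linarith only [hη6, hj4]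
    have hc0 : 0 < η / (2 * (j : ℝ) ^ 2) := by positivity
    have h1 : -(η / (2 * (j : ℝ) ^ 2) * x) ≤ 1 / 48 + -(η / (2 * (j : ℝ) ^ 2) * Real.log (I.P j)) := by
      have h2 := mul_le_mul_of_nonneg_left hxP hc0.le
      have hid : η / (2 * (j : ℝ) ^ 2) * (Real.log (I.P j) - 1) =
          η / (2 * (j : ℝ) ^ 2) * Real.log (I.P j) - η / (2 * (j : ℝ) ^ 2) := by ring
      linarith only [h2, hid, hc]
    have hpos : 0 < I.Q (j - 1) ^ 4 * (j : ℝ) ^ 8 := by positivity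
    calc Real.exp (-(η / (2 * (j : ℝ) ^ 2) * x))
        ≤ Real.exp (1 / 48 + -(η / (2 * (j : ℝ) ^ 2) * Real.log (I.P j))) := Real.exp_le_exp.2 h1
      _ = Real.exp (1 / 48) * (I.P j ^ (η / (2 * (j : ℝ) ^ 2)))⁻¹ := by
          rw [Real.exp_add, Real.exp_neg, Real.rpow_def_of_pos hPj, mul_comm (Real.log (I.P j))]
      _ ≤ Real.exp (1 / 48) * (I.Q (j - 1) ^ 4 * (j : ℝ) ^ 8)⁻¹ := by
          gcongr
  -- assemble
  set ℓ := ⌈x / y⌉₊ with hℓ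
  set F := ((2 : ℝ) ^ ℓ * (((ℓ + 1).factorial : ℕ) : ℝ) ^ 2) with hF
  have hF1 : 1 ≤ (2 : ℝ) ^ ℓ * Real.exp y := by
    have h1 : (1 : ℝ) ≤ 2 ^ ℓ := one_le_pow₀ (by norm_num)
    have h2 : 1 ≤ Real.exp y := by linarith
    exact one_le_mul_of_one_le_of_one_le h1 h2
  have hstep1 : max C₁₃ 0 * (T / X + 2 ^ ℓ * Real.exp y) * (((ℓ + 1).factorial : ℕ) : ℝ) ^ 2 ≤
      max C₁₃ 0 * (T / X + 1) * Real.exp y * F := by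
    have hTX : 0 ≤ T / X := by positivity
    have h1 : T / X + 2 ^ ℓ * Real.exp y ≤ (T / X + 1) * (2 ^ ℓ * Real.exp y) := by
      nlinarith only [hTX, hF1]
    calc max C₁₃ 0 * (T / X + 2 ^ ℓ * Real.exp y) * (((ℓ + 1).factorial : ℕ) : ℝ) ^ 2
        ≤ max C₁₃ 0 * ((T / X + 1) * (2 ^ ℓ * Real.exp y)) * (((ℓ + 1).factorial : ℕ) : ℝ) ^ 2 := by
          gcongr
      _ = max C₁₃ 0 * (T / X + 1) * Real.exp y * F := by rw [hF]; ring
  have hmain' : ∫ t in I.Tsub (fun p => ((f p : ℝ) : ℂ)) T₀ T j r,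
      ‖blockPrimePoly (fun p => ((f p : ℝ) : ℂ)) (I.P j) (I.Q j) (I.Hpar j) v t *
        blockCofactorPoly (I.bCoef f j) X (I.P j) (I.Q j) (I.Hpar j) v t‖ ^ 2 ≤
      max C₁₃ 0 * (T / X + 1) * Real.exp y *
        (Real.exp (-(2 * alpha η j * x)) * Real.exp (2 * ℓ * (alpha η (j - 1) * y)) * F) := by
    refine hmain.trans ?_
    have := mul_le_mul_of_nonneg_left hstep1
      (mul_nonneg (Real.exp_pos (-(2 * alpha η j * x))).le
        (Real.exp_pos (2 * ℓ * (alpha η (j - 1) * y))).le)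
    linarith only [this]
  have hexp' : Real.exp (-(2 * alpha η j * x)) * Real.exp (2 * ℓ * (alpha η (j - 1) * y)) * F ≤
      Real.exp (-(η / (2 * (j : ℝ) ^ 2) * x)) * Real.exp (Real.log (I.Q (j - 1)) / 2) *
        Real.log (I.Q j) ^ 4 * Real.exp 6 := hexp
  -- numeric: `e^{6 + 1/48} ≤ e^7`
  have he7 : Real.exp (1 / 48) * Real.exp 6 ≤ Real.exp 7 := by
    rw [← Real.exp_add]; exact Real.exp_le_exp.2 (by norm_num)
  calc ∫ t in I.Tsub (fun p => ((f p : ℝ) : ℂ)) T₀ T j r,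
        ‖blockPrimePoly (fun p => ((f p : ℝ) : ℂ)) (I.P j) (I.Q j) (I.Hpar j) v t *
          blockCofactorPoly (I.bCoef f j) X (I.P j) (I.Q j) (I.Hpar j) v t‖ ^ 2
      ≤ max C₁₃ 0 * (T / X + 1) * Real.exp y *
          (Real.exp (-(η / (2 * (j : ℝ) ^ 2) * x)) * Real.exp (Real.log (I.Q (j - 1)) / 2) *
            Real.log (I.Q j) ^ 4 * Real.exp 6) :=
        hmain'.trans (mul_le_mul_of_nonneg_left hexp' (by positivity))
    _ ≤ max C₁₃ 0 * (T / X + 1) * I.Q (j - 1) *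
          ((Real.exp (1 / 48) * (I.Q (j - 1) ^ 4 * (j : ℝ) ^ 8)⁻¹) * I.Q (j - 1) ^ (1 / 2 : ℝ) *
            I.Q (j - 1) ^ (4 / 96 : ℝ) * Real.exp 6) := by
        rw [heL'] at *
        gcongr
    _ = max C₁₃ 0 * (T / X + 1) * ((Real.exp (1 / 48) * Real.exp 6) / (j : ℝ) ^ 8 *
          (I.Q (j - 1) * (I.Q (j - 1) ^ (1 / 2 : ℝ) * I.Q (j - 1) ^ (4 / 96 : ℝ)) * (I.Q (j - 1) ^ 4)⁻¹)) := by
        field_simp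
    _ ≤ max C₁₃ 0 * (T / X + 1) * (Real.exp 7 / (j : ℝ) ^ 8 * I.Q (j - 1) ^ (-(59 / 24) : ℝ)) := by
        rw [rpow_aux hA]
        gcongr

/-! ### The bound for `E_j`, `j ≥ 2` -/

/-- `e⁷ ≤ 1100`. [folklore] -/
theorem exp_seven_le : Real.exp 7 ≤ 1100 := by
  have h : Real.exp 7 = Real.exp 1 ^ 7 := by rw [← Real.exp_nat_mul]; norm_num
  rw [h]
  have h1 := Real.exp_one_lt_d9
  have h0 := (Real.exp_pos 1).le
  calc Real.exp 1 ^ 7 ≤ (2.7182818286 : ℝ) ^ 7 := pow_le_pow_left₀ h0 h1.le 7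
    _ ≤ 1100 := by norm_num

/-- `Q_{j-1} ≥ Q₁ ≥ P₁` for `j ≥ 2`. [folklore] -/
theorem P_one_le_Q_pred (hη : 0 < η) (hη' : η ≤ 8) {j : ℕ} (hj : 2 ≤ j) : I.P 1 ≤ I.Q (j - 1) := by
  refine (I.P_le_Q 1 le_rfl).trans ?_
  rcases eq_or_lt_of_le (show 1 ≤ j - 1 by omega) with h | h
  · rw [← h]
  · exact (I.Q_lt_Q hη hη' le_rfl h).le

/-- **§8.2, the bound for `E_j` (`2 ≤ j`)**: with `C₁₂ = 20000` and the constant `C₁₃` of Lemma 13, for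
`0 < η < 1/6`, `H₁ ≥ 2`, `X, T ≥ 1`, `T₀ ≥ 0`,
`C₁₂ H_j log(Q_j/P_j) ∑_{v∈ℐ_j} ∫_{𝒯_j} |Q_{v,H_j} R_{v,H_j}|² ≤ 10⁸ max(C₁₃,0) (T/X + 1)/(j² Q_{j-1})`
(the paper: "`E_j ≪ (T/X + 1) j⁶ Q_{j-1}³ exp(-(η/(2j²)) log P_j) ≪ (T/X + 1)/(j² Q_{j-1}) ≪ (T/X + 1)/(j² P_1)`").
[cite: MatomakiRadziwillAnnals2016, §8.2] -/
theorem E_j_le {C₁₃ : ℝ}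
    (h13 : ∀ (X T Y₁ Y₂ : ℝ) (a c : ℕ → ℂ), 1 ≤ X → 1 ≤ T → 2 ≤ Y₁ → 1 ≤ Y₂ →
      (∀ m, ‖a m‖ ≤ 1) → (∀ p, ‖c p‖ ≤ 1) →
      ∫ t in (-T)..T,
          ‖(∑ p ∈ (Icc ⌈Y₁⌉₊ ⌊2 * Y₁⌋₊).filter Nat.Prime, c p * (p : ℂ) ^ (-(1 + (t : ℂ) * Complex.I)))
                ^ ⌈Real.log Y₂ / Real.log Y₁⌉₊
            * ∑ m ∈ Icc ⌈X / Y₂⌉₊ ⌊2 * X / Y₂⌋₊, a m * (m : ℂ) ^ (-(1 + (t : ℂ) * Complex.I))‖ ^ 2 ≤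
        C₁₃ * (T / X + 2 ^ ⌈Real.log Y₂ / Real.log Y₁⌉₊ * Y₁)
          * ((⌈Real.log Y₂ / Real.log Y₁⌉₊ + 1).factorial : ℝ) ^ 2)
    (hη : 0 < η) (hη6 : η < 1 / 6) (f : ArithmeticFunction ℝ) (hf1 : ∀ n, |f n| ≤ 1) (hX : 1 ≤ X)
    {T₀ T : ℝ} (hT₀ : 0 ≤ T₀) (hT : 1 ≤ T) {j : ℕ} (hj : 2 ≤ j) (hH1 : 2 ≤ I.Hpar 1) :
    20000 * ((I.Hpar j * Real.log (I.Q j / I.P j)) *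
        (∑ v ∈ I.blocks j, ∫ t in I.Tset (fun p => ((f p : ℝ) : ℂ)) T₀ T j,
          ‖blockPrimePoly (fun p => ((f p : ℝ) : ℂ)) (I.P j) (I.Q j) (I.Hpar j) v t *
            blockCofactorPoly (I.bCoef f j) X (I.P j) (I.Q j) (I.Hpar j) v t‖ ^ 2)) ≤
      100000000 * max C₁₃ 0 * (T / X + 1) / ((j : ℝ) ^ 2 * I.Q (j - 1)) := by
  have hη' : η ≤ 8 := by linarith
  have hη'' : η ≤ 1 / 6 := hη6.le
  have hj1 : 1 ≤ j - 1 := by omega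
  have hjj : 1 ≤ j := by omega
  have hj2 : (2 : ℝ) ≤ j := by exact_mod_cast hj
  have hHj1 : 2 ≤ I.Hpar j := hH1.trans (I.Hpar_one_le hη hη' hjj)
  have hHi1 : 2 ≤ I.Hpar (j - 1) := hH1.trans (I.Hpar_one_le hη hη' hj1)
  have hHj0 : 0 < I.Hpar j := by linarith
  have hA : 0 < I.Q (j - 1) := I.pos_Q hj1
  have hA1 : 1 ≤ I.Q (j - 1) := I.one_le_Q hη hη' hj1
  have hQ : 0 < I.Q j := I.pos_Q hjj
  have hP : 0 < I.P j := I.pos_P j hjj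
  have hlogA : 1 < Real.log (I.Q (j - 1)) := I.one_lt_logQ hη hη'' hj1
  have hL : 1 < Real.log (I.Q j) := I.one_lt_logQ hη hη'' hjj
  have hT0 : 0 < T := by linarith
  have hX0 : 0 < X := by linarith
  set c : ℕ → ℂ := fun p => ((f p : ℝ) : ℂ) with hc
  set B := max C₁₃ 0 * (T / X + 1) * (Real.exp 7 / (j : ℝ) ^ 8 * I.Q (j - 1) ^ (-(59 / 24) : ℝ)) with hB
  have hB0 : 0 ≤ B := by positivity
  -- split `∫_{𝒯_j}` along the `𝒯_{j,r}` and bound each piece by `B`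
  have hsum : ∑ v ∈ I.blocks j, ∫ t in I.Tset c T₀ T j,
      ‖blockPrimePoly c (I.P j) (I.Q j) (I.Hpar j) v t *
        blockCofactorPoly (I.bCoef f j) X (I.P j) (I.Q j) (I.Hpar j) v t‖ ^ 2 ≤
      #(I.blocks j) * (#(I.blocks (j - 1)) * B) := by
    rw [← nsmul_eq_mul, ← sum_const]
    refine sum_le_sum fun v hv => ?_
    have hcont : Continuous fun t => ‖blockPrimePoly c (I.P j) (I.Q j) (I.Hpar j) v t *
        blockCofactorPoly (I.bCoef f j) X (I.P j) (I.Q j) (I.Hpar j) v t‖ ^ 2 := by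
      refine ((Continuous.mul ?_ ?_).norm).pow 2
      · unfold blockPrimePoly; exact MatomakiRadziwillLemma12.continuous_dsum _ _
      · unfold blockCofactorPoly
        exact continuous_finsetSum _ fun m _ =>
          (continuous_const.mul (MatomakiRadziwillLemma12.continuous_cpw m)).div_const _
    have hsubT : I.Tset c T₀ T j ⊆ Set.Icc (-T) T :=
      (I.Tset_subset c T₀ T j).trans (Set.Icc_subset_Icc (by linarith) le_rfl)
    rw [I.integral_Tset_eq_sum_Tsub c T₀ T hj
      (MatomakiRadziwillLemma12.integrableOn_of_continuous hcont hsubT), ← nsmul_eq_mul, ← sum_const]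
    refine sum_le_sum fun r hr => ?_
    exact I.integral_Tsub_le' h13 hη hη6 f hf1 hX hT₀ hT hj hH1 hr hv
  -- sizes
  have hIj : (#(I.blocks j) : ℝ) ≤ 2 * (I.Hpar j * Real.log (I.Q j)) :=
    I.card_blocks_le hη hη'' hjj (by linarith)
  have hIi : (#(I.blocks (j - 1)) : ℝ) ≤ 2 * (I.Hpar j * Real.log (I.Q j)) := by
    refine (I.card_blocks_le hη hη'' hj1 (by linarith)).trans ?_
    have h1 : I.Hpar (j - 1) ≤ I.Hpar j := by
      rw [I.Hpar_eq (j - 1), I.Hpar_eq j]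
      have : ((j - 1 : ℕ) : ℝ) ^ 2 ≤ (j : ℝ) ^ 2 := by
        have h0 : ((j - 1 : ℕ) : ℝ) ≤ j := by exact_mod_cast Nat.sub_le j 1
        exact pow_le_pow_left₀ (Nat.cast_nonneg _) h0 2
      exact mul_le_mul_of_nonneg_right this (I.Hpar_one_pos hη hη').le
    have h2 : Real.log (I.Q (j - 1)) ≤ Real.log (I.Q j) := by
      refine Real.log_le_log hA ?_
      have := I.Q_lt_Q hη hη' hj1 (show j - 1 < j by omega)
      exact this.le
    have : I.Hpar (j - 1) * Real.log (I.Q (j - 1)) ≤ I.Hpar j * Real.log (I.Q j) :=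
      mul_le_mul h1 h2 (by linarith) hHj0.le
    linarith
  have hlogQP : Real.log (I.Q j / I.P j) ≤ Real.log (I.Q j) := by
    rw [Real.log_div hQ.ne' hP.ne']
    linarith [I.two_le_logP hη hη'' hjj]
  have hlogQP0 : 0 ≤ Real.log (I.Q j / I.P j) := by
    rw [Real.log_div hQ.ne' hP.ne']
    linarith [Real.log_le_log hP (I.P_le_Q j hjj)]
  have hH3 : I.Hpar j ^ 3 ≤ (j : ℝ) ^ 6 * I.Q (j - 1) ^ (1 / 2 : ℝ) := by
    refine (I.Hpar_cube_le hη hη'' j).trans ?_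
    exact mul_le_mul_of_nonneg_left
      (Real.rpow_le_rpow (I.pos_P 1 le_rfl).le (I.P_one_le_Q_pred hη hη' hj) (by norm_num))
      (by positivity)
  have hL3 : Real.log (I.Q j) ^ 3 ≤ I.Q (j - 1) ^ (3 / 96 : ℝ) := by
    have h := I.logQ_le_Q_pred_rpow hη hη'' hj
    calc Real.log (I.Q j) ^ 3 ≤ (I.Q (j - 1) ^ (1 / 96 : ℝ)) ^ 3 := pow_le_pow_left₀ (by linarith) h 3
      _ = I.Q (j - 1) ^ (3 / 96 : ℝ) := by rw [← Real.rpow_natCast, ← Real.rpow_mul hA.le]; norm_num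
  -- the main product
  set HL := I.Hpar j * Real.log (I.Q j) with hHL
  have hHL0 : 0 ≤ HL := by positivity
  have hprod : 20000 * ((I.Hpar j * Real.log (I.Q j / I.P j)) *
      (∑ v ∈ I.blocks j, ∫ t in I.Tset c T₀ T j,
        ‖blockPrimePoly c (I.P j) (I.Q j) (I.Hpar j) v t *
          blockCofactorPoly (I.bCoef f j) X (I.P j) (I.Q j) (I.Hpar j) v t‖ ^ 2)) ≤
      80000 * HL ^ 3 * B := by
    have h1 : I.Hpar j * Real.log (I.Q j / I.P j) ≤ HL := mul_le_mul_of_nonneg_left hlogQP hHj0.le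
    have h2 : (∑ v ∈ I.blocks j, ∫ t in I.Tset c T₀ T j,
        ‖blockPrimePoly c (I.P j) (I.Q j) (I.Hpar j) v t *
          blockCofactorPoly (I.bCoef f j) X (I.P j) (I.Q j) (I.Hpar j) v t‖ ^ 2) ≤ (2 * HL) * ((2 * HL) * B) :=
      hsum.trans (mul_le_mul hIj (mul_le_mul_of_nonneg_right hIi hB0) (by positivity) (by positivity))
    have h0 : 0 ≤ ∑ v ∈ I.blocks j, ∫ t in I.Tset c T₀ T j,
        ‖blockPrimePoly c (I.P j) (I.Q j) (I.Hpar j) v t *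
          blockCofactorPoly (I.bCoef f j) X (I.P j) (I.Q j) (I.Hpar j) v t‖ ^ 2 :=
      sum_nonneg fun v _ => integral_nonneg fun t => by positivity
    calc 20000 * ((I.Hpar j * Real.log (I.Q j / I.P j)) * _)
        ≤ 20000 * (HL * ((2 * HL) * ((2 * HL) * B))) := by
          gcongr 20000 * ?_
          exact mul_le_mul h1 h2 h0 hHL0
      _ = 80000 * HL ^ 3 * B := by ring
  have hHL3 : HL ^ 3 ≤ (j : ℝ) ^ 6 * (I.Q (j - 1) ^ (1 / 2 : ℝ) * I.Q (j - 1) ^ (3 / 96 : ℝ)) := by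
    rw [hHL, mul_pow]
    calc I.Hpar j ^ 3 * Real.log (I.Q j) ^ 3 ≤ ((j : ℝ) ^ 6 * I.Q (j - 1) ^ (1 / 2 : ℝ)) * I.Q (j - 1) ^ (3 / 96 : ℝ) :=
          mul_le_mul hH3 hL3 (by positivity) (by positivity)
      _ = _ := by ring
  -- rpow bookkeeping: `A^{1/2} A^{3/96} A^{-59/24} = A^{-185/96} ≤ A^{-1}`
  have hrpow : I.Q (j - 1) ^ (1 / 2 : ℝ) * I.Q (j - 1) ^ (3 / 96 : ℝ) * I.Q (j - 1) ^ (-(59 / 24) : ℝ) ≤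
      (I.Q (j - 1))⁻¹ := by
    rw [← Real.rpow_add hA, ← Real.rpow_add hA, ← Real.rpow_neg_one]
    refine Real.rpow_le_rpow_of_exponent_le hA1 ?_
    norm_num
  calc 20000 * ((I.Hpar j * Real.log (I.Q j / I.P j)) *
        (∑ v ∈ I.blocks j, ∫ t in I.Tset c T₀ T j,
          ‖blockPrimePoly c (I.P j) (I.Q j) (I.Hpar j) v t *
            blockCofactorPoly (I.bCoef f j) X (I.P j) (I.Q j) (I.Hpar j) v t‖ ^ 2))
      ≤ 80000 * HL ^ 3 * B := hprod
    _ ≤ 80000 * ((j : ℝ) ^ 6 * (I.Q (j - 1) ^ (1 / 2 : ℝ) * I.Q (j - 1) ^ (3 / 96 : ℝ))) * B := by gcongr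
    _ = 80000 * Real.exp 7 * max C₁₃ 0 * (T / X + 1) *
          ((I.Q (j - 1) ^ (1 / 2 : ℝ) * I.Q (j - 1) ^ (3 / 96 : ℝ) * I.Q (j - 1) ^ (-(59 / 24) : ℝ)) /
            (j : ℝ) ^ 2) := by
        rw [hB]
        field_simp
    _ ≤ 80000 * 1100 * max C₁₃ 0 * (T / X + 1) * ((I.Q (j - 1))⁻¹ / (j : ℝ) ^ 2) := by
        gcongr
        exact exp_seven_le
    _ ≤ 100000000 * max C₁₃ 0 * (T / X + 1) / ((j : ℝ) ^ 2 * I.Q (j - 1)) := by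
        rw [show 100000000 * max C₁₃ 0 * (T / X + 1) / ((j : ℝ) ^ 2 * I.Q (j - 1)) =
          100000000 * max C₁₃ 0 * (T / X + 1) * ((I.Q (j - 1))⁻¹ / (j : ℝ) ^ 2) by field_simp]
        gcongr
        norm_num

end SieveIntervalSystem

end Literature.NumberTheory.Sieve
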